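import Summits.QuantumFields.GaugeBoot.ZdReflectionRelabelling
import HarnessLib

/-!
# The group `ℤ₂^d` of axis reflections of `ℤ^d` acting on lattice gauge configurations (gauge-boot, L1/L4 supplement)

HONEST FRAMING (cell `pub-gaugeboot`, page 1 of every file): the venture produces certified bounds
on lattice expectations at stated coupling, gauge group, dimension and torus size; NOT a mass gap,
NOT a continuum limit, NOT a string tension; NOT Yang–Mills-summit-bearing (barriers
`FixedCouplingUltralocality`, `PerturbativeInvisibility`). Structural; it certifies no number.

## Content

The `d` commuting axis reflections `Θ_i` (`ZdReflectionRelabelling`) generate the group `ℤ₂^d`;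
its Reynolds operator is a finite average, for which `BootstrapSymmetryReduction.avgFunctional`
wants the group as a FAMILY of maps closed under composition. Indexed by `s : Finset (Fin d)` (the
set of reflected axes):

* `zdReflect s` (negate the coordinates in `s`), `zdReflEdges s` (the link read: `s`-links are
  shifted back by their unit vector), ★ `reflectCM s = revRelabelCM (zdReflEdges s) (·.2 ∈ s)` — a
  link-reversing relabelling reversing exactly the links along the axes of `s`;
* `reflectCM_empty = id`, ★ `reflectCM_singleton : reflectCM {i} = zdSiteReflectCM i`, ★★
  `reflectCM_comp : Θ_s ∘ Θ_t = Θ_{s ∆ t}` (the group law of `ℤ₂^d`), `reflectCM_comm`,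
  `reflectCM_reflectCM` (involutions), `exists_equiv_reflectCM_comp` (the closure property
  `avgFunctional_comp_eq` wants);
* ★ `reflectCM_comp_edgeShift` (`Θ_s ∘ τ_v^* = τ_{θ_s v}^* ∘ Θ_s`), ★ `reflectCM_comp_edgePerm`
  (`Θ_s ∘ π_σ^* = π_σ^* ∘ Θ_{σ s}`) and their observable forms — `ℤ₂^d`, the translations and the axis
  permutations generate the hyperoctahedral space group `B_d ⋉ ℤ^d`;
* ★★ `wilsonBoundaryAction_single_reflect` — the one-link Wilson boundary actions are covariant
  under every `Θ_s` (induction on `s` from the one-axis case); `comp_reflectCM_mem_wordTruncation`,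
  `comp_reflectCM_mem_polyAlgebra`.

References: V. Kazakov, Z. Zheng, arXiv:2203.11360 §3.3; K. Gatermann, P. A. Parrilo, J. Pure Appl.
Algebra 192 (2004) 95, Thm 3.3. Folklore.
-/

noncomputable section

open Literature.MathematicalPhysics.QuantumFieldTheory (LatticeRep)
open Literature.Probability.LatticeModels (Site)
open Literature.MathematicalPhysics.QuantumLattice

namespace Summit.QuantumFields.GaugeBoot

/-! ## Multi-axis reflections of sites and links -/

section Sites

variable {d : ℕ} (s : Finset (Fin d))

/-- **The reflection in the axes of `s`**: negate the coordinates `k ∈ s`. [folklore] -/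
def zdReflect (x : Site d) : Site d := fun k => if k ∈ s then -x k else x k

/-- `zdReflect` evaluated. -/
theorem zdReflect_apply (x : Site d) (k : Fin d) : zdReflect s x k = if k ∈ s then -x k else x k := rfl

/-- An involution. -/
@[simp] theorem zdReflect_zdReflect (x : Site d) : zdReflect s (zdReflect s x) = x := by
  ext k
  by_cases hk : k ∈ s <;> simp [zdReflect_apply, hk]

/-- Additive. -/
theorem zdReflect_add (x y : Site d) : zdReflect s (x + y) = zdReflect s x + zdReflect s y := by
  ext k
  by_cases hk : k ∈ s <;> simp [zdReflect_apply, hk, add_comm]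

/-- Commutes with subtraction. -/
theorem zdReflect_sub (x y : Site d) : zdReflect s (x - y) = zdReflect s x - zdReflect s y := by
  ext k
  by_cases hk : k ∈ s
  · simp only [zdReflect_apply, hk, ↓reduceIte, Pi.sub_apply]; ring
  · simp only [zdReflect_apply, hk, ↓reduceIte, Pi.sub_apply]

/-- `zdReflect s 0 = 0`. -/
@[simp] theorem zdReflect_zero : zdReflect s (0 : Site d) = 0 := by
  ext k; simp [zdReflect_apply]

/-- Reverses the unit vectors of the axes in `s`. -/
theorem zdReflect_single_mem {k : Fin d} (hk : k ∈ s) (c : ℤ) :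
    zdReflect s (Pi.single k c : Site d) = -Pi.single k c := by
  ext m
  by_cases hm : m = k
  · subst hm; simp [zdReflect_apply, hk]
  · simp [zdReflect_apply, Pi.single_eq_of_ne hm]

/-- Fixes the other unit vectors. -/
theorem zdReflect_single_not_mem {k : Fin d} (hk : k ∉ s) (c : ℤ) :
    zdReflect s (Pi.single k c : Site d) = Pi.single k c := by
  ext m
  by_cases hm : m = k
  · subst hm; simp [zdReflect_apply, hk]
  · simp [zdReflect_apply, Pi.single_eq_of_ne hm]

/-- No axis: the identity. -/
@[simp] theorem zdReflect_empty (x : Site d) : zdReflect ∅ x = x := by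
  ext k; simp [zdReflect_apply]

/-- One axis: the site reflection of `ClassB`. -/
theorem zdReflect_singleton (i : Fin d) (x : Site d) : zdReflect {i} x = zdSiteReflect i x := by
  ext k; simp only [zdReflect_apply, Finset.mem_singleton, zdSiteReflect_apply]
  split_ifs with h
  · rw [h]
  · rfl

/-- **The group law** on sites: `θ_s ∘ θ_t = θ_{s ∆ t}`. -/
theorem zdReflect_zdReflect_eq_symmDiff (t : Finset (Fin d)) (x : Site d) :
    zdReflect s (zdReflect t x) = zdReflect (symmDiff s t) x := by
  ext k
  simp only [zdReflect_apply, Finset.mem_symmDiff]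
  by_cases hs : k ∈ s <;> by_cases ht : k ∈ t <;> simp [hs, ht]

/-- Axis permutations conjugate the reflections: `θ_{σ s} (x ∘ σ⁻¹) = (θ_s x) ∘ σ⁻¹`. -/
theorem zdReflect_map_sitePerm (σ : Equiv.Perm (Fin d)) (x : Site d) :
    zdReflect (s.map σ.toEmbedding) (sitePerm σ x) = sitePerm σ (zdReflect s x) := by
  ext k
  simp only [zdReflect_apply, sitePerm_apply, Finset.mem_map_equiv]

end Sites

section Edges

variable {d : ℕ} (s : Finset (Fin d))

/-- **The link read by the reflection `Θ_s`**: base point reflected, and shifted back by its own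
unit vector when the link lies along a reflected axis (then it is read reversed). [folklore] -/
def zdReflEdges (e : ZdEdge d) : ZdEdge d :=
  (zdReflect s e.1 - (if e.2 ∈ s then Pi.single e.2 1 else 0), e.2)

/-- The axis is kept. -/
@[simp] theorem zdReflEdges_snd (e : ZdEdge d) : (zdReflEdges s e).2 = e.2 := rfl

/-- The base point. -/
theorem zdReflEdges_fst (e : ZdEdge d) :
    (zdReflEdges s e).1 = zdReflect s e.1 - (if e.2 ∈ s then Pi.single e.2 1 else 0) := rfl

/-- An involution. -/
@[simp] theorem zdReflEdges_zdReflEdges (e : ZdEdge d) : zdReflEdges s (zdReflEdges s e) = e := by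
  refine Prod.ext ?_ rfl
  simp only [zdReflEdges, zdReflect_sub, zdReflect_zdReflect]
  by_cases he : e.2 ∈ s
  · rw [if_pos he, zdReflect_single_mem s he, sub_neg_eq_add, add_sub_cancel_right]
  · rw [if_neg he, zdReflect_zero, sub_zero, sub_zero]

/-- Injective. -/
theorem zdReflEdges_injective : Function.Injective (zdReflEdges (d := d) s) := fun e e' h => by
  rw [← zdReflEdges_zdReflEdges s e, h, zdReflEdges_zdReflEdges]

/-- No axis: the identity. -/
@[simp] theorem zdReflEdges_empty (e : ZdEdge d) : zdReflEdges ∅ e = e := by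
  refine Prod.ext ?_ rfl
  simp [zdReflEdges]

/-- One axis: `zdReflEdge i`. -/
theorem zdReflEdges_singleton (i : Fin d) (e : ZdEdge d) : zdReflEdges {i} e = zdReflEdge i e := by
  by_cases he : e.2 = i
  · rw [zdReflEdge_of_eq i he]
    refine Prod.ext ?_ he
    simp only [zdReflEdges, Finset.mem_singleton, he, ↓reduceIte, zdReflect_singleton]
  · rw [zdReflEdge_of_ne i he]
    refine Prod.ext ?_ rfl
    simp only [zdReflEdges, Finset.mem_singleton, he, ↓reduceIte, zdReflect_singleton, sub_zero]

/-- **The group law** on links: `θ_s ∘ θ_t = θ_{s ∆ t}`. -/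
theorem zdReflEdges_zdReflEdges_eq_symmDiff (t : Finset (Fin d)) (e : ZdEdge d) :
    zdReflEdges s (zdReflEdges t e) = zdReflEdges (symmDiff s t) e := by
  refine Prod.ext ?_ rfl
  simp only [zdReflEdges, zdReflect_sub, zdReflect_zdReflect_eq_symmDiff, Finset.mem_symmDiff]
  by_cases hs : e.2 ∈ s <;> by_cases ht : e.2 ∈ t
  · simp only [hs, ht, ↓reduceIte, not_true_eq_false, and_false, or_self, zdReflect_single_mem s hs,
      sub_neg_eq_add, add_sub_cancel_right, sub_zero]
  · simp only [hs, ht, ↓reduceIte, not_false_eq_true, and_self, not_true_eq_false, or_false,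
      zdReflect_zero, sub_zero]
  · simp only [hs, ht, ↓reduceIte, not_true_eq_false, not_false_eq_true, and_self, false_or,
      zdReflect_single_not_mem s hs, sub_zero]
  · simp only [hs, ht, ↓reduceIte, not_false_eq_true, and_true, or_self, zdReflect_zero, sub_zero]

/-- The reflections commute on links. -/
theorem zdReflEdges_comm (t : Finset (Fin d)) (e : ZdEdge d) :
    zdReflEdges s (zdReflEdges t e) = zdReflEdges t (zdReflEdges s e) := by
  rw [zdReflEdges_zdReflEdges_eq_symmDiff, zdReflEdges_zdReflEdges_eq_symmDiff, symmDiff_comm]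

/-- **`Θ_s` normalises the translations**: `θ_s (e + v) = θ_s e + θ_s v`. -/
theorem zdReflEdges_edgeShift (v : Site d) (e : ZdEdge d) :
    zdReflEdges s (edgeShift v e) = edgeShift (zdReflect s v) (zdReflEdges s e) := by
  refine Prod.ext ?_ rfl
  simp only [zdReflEdges, edgeShift_apply, zdReflect_add]
  abel

/-- **Axis permutations conjugate the reflections**: `θ_{σ s} (π_σ e) = π_σ (θ_s e)`. -/
theorem zdReflEdges_map_edgePerm (σ : Equiv.Perm (Fin d)) (e : ZdEdge d) :
    zdReflEdges (s.map σ.toEmbedding) (edgePerm σ e) = edgePerm σ (zdReflEdges s e) := by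
  refine Prod.ext ?_ rfl
  simp only [zdReflEdges, Literature.MathematicalPhysics.QuantumLattice.edgePerm_apply,
    zdReflect_map_sitePerm, Finset.mem_map_equiv, Equiv.symm_apply_apply, sitePerm_sub]
  by_cases he : e.2 ∈ s
  · rw [if_pos he, if_pos he, sitePerm_single]
  · rw [if_neg he, if_neg he]
    rfl

/-- `σ (σ⁻¹ s) = s` for finsets of axes. -/
theorem map_symm_map_perm (σ : Equiv.Perm (Fin d)) :
    (s.map σ.symm.toEmbedding).map σ.toEmbedding = s := by
  ext k
  simp only [Finset.mem_map_equiv, Equiv.symm_symm, Equiv.apply_symm_apply]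

end Edges

/-! ## The reflections of configurations -/

section Config

variable {d : ℕ} {G : Type*} [Group G] [TopologicalSpace G] [IsTopologicalGroup G]
  (s : Finset (Fin d))

/-- ★ **The reflection of configurations in the axes of `s`**: the link-reversing relabelling by
`zdReflEdges s`, reversing the links along the axes of `s`. [folklore] -/
def reflectCM : C(LGConfig d G, LGConfig d G) :=
  revRelabelCM (G := G) (zdReflEdges s) (fun e : ZdEdge d => e.2 ∈ s)

/-- `reflectCM` evaluated. -/
theorem reflectCM_apply_apply (U : LGConfig d G) (e : ZdEdge d) :
    reflectCM (G := G) s U e = if e.2 ∈ s then (U (zdReflEdges s e))⁻¹ else U (zdReflEdges s e) := rfl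

/-- No axis: the identity. -/
@[simp] theorem reflectCM_empty : reflectCM (G := G) (∅ : Finset (Fin d)) = ContinuousMap.id _ := by
  ext U e
  simp [reflectCM_apply_apply]

/-- ★ One axis: the site reflection `Θ_i` (`= configSiteReflect i`). -/
theorem reflectCM_singleton (i : Fin d) : reflectCM (G := G) ({i} : Finset (Fin d)) = zdSiteReflectCM (G := G) i := by
  ext U e
  change _ = revRelabelCM (G := G) (zdReflEdge i) (fun e : ZdEdge d => e.2 = i) U e
  simp only [reflectCM_apply_apply, revRelabelCM_apply, Finset.mem_singleton, zdReflEdges_singleton]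

/-- ★★ **The group law of `ℤ₂^d`**: `Θ_s ∘ Θ_t = Θ_{s ∆ t}`. -/
theorem reflectCM_comp (t : Finset (Fin d)) :
    (reflectCM (G := G) s).comp (reflectCM (G := G) t) = reflectCM (G := G) (symmDiff s t) := by
  ext U e
  simp only [ContinuousMap.comp_apply, reflectCM_apply_apply, zdReflEdges_snd, Finset.mem_symmDiff,
    zdReflEdges_comm t s e, zdReflEdges_zdReflEdges_eq_symmDiff]
  by_cases hs : e.2 ∈ s <;> by_cases ht : e.2 ∈ t <;> simp [hs, ht]

/-- The reflections commute. -/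
theorem reflectCM_comm (t : Finset (Fin d)) :
    (reflectCM (G := G) s).comp (reflectCM (G := G) t) = (reflectCM (G := G) t).comp (reflectCM (G := G) s) := by
  rw [reflectCM_comp, reflectCM_comp, symmDiff_comm]

/-- Involutions. -/
@[simp] theorem reflectCM_reflectCM (U : LGConfig d G) : reflectCM (G := G) s (reflectCM (G := G) s U) = U := by
  have h := congrArg (fun F : C(LGConfig d G, LGConfig d G) => F U) (reflectCM_comp (G := G) s s)
  simp only [ContinuousMap.comp_apply, symmDiff_self, Finset.bot_eq_empty, reflectCM_empty,
    ContinuousMap.id_apply] at h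
  exact h

/-- An observable composed twice with `Θ_s` is itself. -/
theorem comp_reflectCM_comp_reflectCM (x : C(LGConfig d G, ℝ)) :
    (x.comp (reflectCM (G := G) s)).comp (reflectCM (G := G) s) = x := by
  rw [ContinuousMap.comp_assoc, reflectCM_comp, symmDiff_self, Finset.bot_eq_empty, reflectCM_empty,
    ContinuousMap.comp_id]

/-- `{i} ∆ s = insert i s` for `i ∉ s`. -/
theorem singleton_symmDiff_eq_insert {i : Fin d} (hi : i ∉ s) : symmDiff {i} s = insert i s := by
  ext k
  simp only [Finset.mem_insert, Finset.mem_symmDiff, Finset.mem_singleton]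
  by_cases hk : k = i
  · subst hk; simp [hi]
  · simp [hk]

/-- Adding one axis: `Θ_{insert i s} = Θ_i ∘ Θ_s` for `i ∉ s`. -/
theorem reflectCM_insert {i : Fin d} (hi : i ∉ s) :
    reflectCM (G := G) (insert i s) = (zdSiteReflectCM (G := G) i).comp (reflectCM (G := G) s) := by
  rw [← reflectCM_singleton, reflectCM_comp, singleton_symmDiff_eq_insert s hi]

/-- **The closure property** of `avgFunctional_comp_eq`: composing with `Θ_s` permutes the family. -/
theorem exists_equiv_reflectCM_comp (δ : Finset (Fin d)) :
    ∃ g : Finset (Fin d) ≃ Finset (Fin d), ∀ γ : Finset (Fin d),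
      (reflectCM (G := G) δ).comp (reflectCM (G := G) γ) = reflectCM (G := G) (g γ) :=
  ⟨⟨fun γ => symmDiff δ γ, fun γ => symmDiff δ γ, fun _ => symmDiff_symmDiff_cancel_left _ _,
    fun _ => symmDiff_symmDiff_cancel_left _ _⟩, fun γ => reflectCM_comp δ γ⟩

/-- ★ **`Θ_s` normalises the translations**: `Θ_s ∘ τ_v^* = τ_{θ_s v}^* ∘ Θ_s`. -/
theorem reflectCM_comp_edgeShift (v : Site d) :
    (reflectCM (G := G) s).comp (relabelCM (edgeShift v)) =
      (relabelCM (G := G) (edgeShift (zdReflect s v))).comp (reflectCM (G := G) s) := by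
  ext U e
  have h2 : (edgeShift (zdReflect s v) e).2 = e.2 := rfl
  simp only [ContinuousMap.comp_apply, reflectCM_apply_apply, relabelCM_apply, h2, zdReflEdges_edgeShift,
    zdReflect_zdReflect]

/-- An observable translated then reflected is the reflected observable translated by `θ_s v`. -/
theorem comp_edgeShift_comp_reflectCM (x : C(LGConfig d G, ℝ)) (v : Site d) :
    (x.comp (relabelCM (G := G) (edgeShift v))).comp (reflectCM (G := G) s) =
      (x.comp (reflectCM (G := G) s)).comp (relabelCM (G := G) (edgeShift (zdReflect s v))) := by
  rw [ContinuousMap.comp_assoc, ContinuousMap.comp_assoc]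
  congr 1
  have h := reflectCM_comp_edgeShift (G := G) s (zdReflect s v)
  rw [zdReflect_zdReflect] at h
  exact h.symm

/-- ★ **Axis permutations conjugate `ℤ₂^d`**: `Θ_s ∘ π_σ^* = π_σ^* ∘ Θ_{σ s}`. -/
theorem reflectCM_comp_edgePerm (σ : Equiv.Perm (Fin d)) :
    (reflectCM (G := G) s).comp (relabelCM (edgePerm σ)) =
      (relabelCM (G := G) (edgePerm σ)).comp (reflectCM (G := G) (s.map σ.toEmbedding)) := by
  ext U e
  have h2 : ((edgePerm σ e).2 ∈ s.map σ.toEmbedding) = (e.2 ∈ s) := by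
    rw [Literature.MathematicalPhysics.QuantumLattice.edgePerm_apply, Finset.mem_map_equiv,
      Equiv.symm_apply_apply]
  simp only [ContinuousMap.comp_apply, reflectCM_apply_apply, relabelCM_apply, zdReflEdges_map_edgePerm, h2]

/-- An observable permuted then reflected is the `σ⁻¹ s`-reflected observable permuted. -/
theorem comp_edgePerm_comp_reflectCM (x : C(LGConfig d G, ℝ)) (σ : Equiv.Perm (Fin d)) :
    (x.comp (relabelCM (G := G) (edgePerm σ))).comp (reflectCM (G := G) s) =
      (x.comp (reflectCM (G := G) (s.map σ.symm.toEmbedding))).comp (relabelCM (G := G) (edgePerm σ)) := by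
  rw [ContinuousMap.comp_assoc, ContinuousMap.comp_assoc]
  congr 1
  have h := reflectCM_comp_edgePerm (G := G) (s.map σ.symm.toEmbedding) σ
  rw [map_symm_map_perm] at h
  exact h.symm

variable (r : LatticeRep G)

/-- The word truncation is `Θ_s`-stable. -/
theorem comp_reflectCM_mem_wordTruncation (n : ℕ) {x : C(LGConfig d G, ℝ)}
    (hx : x ∈ wordTruncation (ι := ZdEdge d) r n) :
    x.comp (reflectCM (G := G) s) ∈ wordTruncation (ι := ZdEdge d) r n :=
  comp_revRelabelCM_mem_wordTruncation r _ _ hx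

/-- The polynomial observables are `Θ_s`-stable. -/
theorem comp_reflectCM_mem_polyAlgebra {x : C(LGConfig d G, ℝ)} (hx : x ∈ polyAlgebra (ι := ZdEdge d) r) :
    x.comp (reflectCM (G := G) s) ∈ polyAlgebra (ι := ZdEdge d) r :=
  comp_revRelabelCM_mem_polyAlgebra r _ _ hx

end Config

/-! ## Covariance of the one-link Wilson boundary actions under `ℤ₂^d` -/

section Action

variable {d : ℕ} {G : Type*} [Group G] {N : ℕ} (ρ : G →* Matrix (Fin N) (Fin N) ℂ)
  [TopologicalSpace G] [IsTopologicalGroup G] [CompactSpace G]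

/-- ★★ **The one-link Wilson boundary actions are covariant under every `Θ_s`**:
`S_e (Θ_s U) = S_{θ_s e} U` (induction on the set of axes). -/
theorem wilsonBoundaryAction_single_reflect (hρ : Continuous ρ) (s : Finset (Fin d)) (e : ZdEdge d)
    (U : LGConfig d G) :
    wilsonBoundaryAction ρ {e} (reflectCM (G := G) s U) = wilsonBoundaryAction ρ {zdReflEdges s e} U := by
  induction s using Finset.induction_on generalizing e U with
  | empty => rw [reflectCM_empty, ContinuousMap.id_apply, zdReflEdges_empty]
  | insert i s hi ih =>
    rw [reflectCM_insert s hi, ContinuousMap.comp_apply, wilsonBoundaryAction_single_siteReflect i ρ hρ, ih,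
      ← zdReflEdges_singleton, zdReflEdges_zdReflEdges_eq_symmDiff, symmDiff_comm,
      singleton_symmDiff_eq_insert s hi]

end Action

end Summit.QuantumFields.GaugeBoot

end
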